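import Literature.Geometry.Riemannian.SelfDualRigidity
import Literature.Topology.FourManifolds.ConnectedSumExistence
import Literature.Topology.FourManifolds.ConnectedSumSphereIdentity
import HarnessLib

/-!
# Pedersen–Poon rigidity, chain form — proofs file (I): the standard chain `S⁴, S⁴ # ℂℙ², …`

Sibling of `SelfDualRigidity.lean`, which vends the named fact
`Literature.Geometry.Riemannian.PedersenPoon1994_selfDual_rigidity_chain` (Pedersen–Poon 1994,
Cor. 2.1, rendered on blown-up homotopy 4-spheres: the conclusion asks for a chain of closed smooth
4-manifolds `Q 0 ≅ S⁴`, `Q (i + 1)` a connected sum `Q i # ℂℙ²`, and a diffeomorphism `P n ≅ Q n`).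

The printed proof ends with "`M` diffeomorphic to `S⁴ # τℂℙ² ≅ τℂℙ²`" (H. Pedersen, *Self-duality
and connected sums of complex projective planes*, Ch. 10 of S. Huggett (ed.), *Twistor Theory*,
end of §3; Pedersen–Poon, Proc. AMS 121 (1994), Thm. 2.1 / Cor. 2.1). Of this, the tree can at
present carry exactly the differential-topological skeleton: that the reference manifolds
`nℂℙ² = S⁴ # ℂℙ² # ⋯ # ℂℙ²` EXIST as closed smooth 4-manifolds arranged in such a chain. That is
the theorem of this file,

* `Literature.Geometry.Riemannian.exists_sphere_connectedSum_complexProjectivePlane_chain` — there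
  is a sequence `Q : ℕ → Type` of nonempty closed (compact, Hausdorff, second countable) smooth
  4-manifolds with `Q 0 ≅ S⁴` and `Q (i + 1)` a connected sum `Q i # ℂℙ²`
  (`Literature.Topology.FourManifolds.IsConnectedSum`) for EVERY `i`,

obtained by iterating along `ℕ` the existence of connected sums of nonempty closed smooth
`n`-manifolds, `Literature.Topology.FourManifolds.exists_isConnectedSum_holds`
(`ConnectedSumExistence.lean`; Kervaire–Milnor 1963, §2; Kosinski 1993, VI.1), starting from the
round sphere; the recursion runs over an anonymous `Σ`-type of bundled closed 4-manifolds, so no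
auxiliary definition is introduced. Its corollary
`Literature.Geometry.Riemannian.exists_sphere_connectedSum_complexProjectivePlane_chain_lt` has
literally the shape of the `∃ Q …` clause of the named fact (chain condition for `i < n`).

The geometric content of Cor. 2.1 (twistor space, real degree-2 divisors, `b₋ = 0`, surface
classification, "blowing up a point is a connected sum with `ℂℙ²`"), i.e. the diffeomorphism
`P n ≅ Q n`, is NOT formalised here; see the module docstring of `SelfDualRigidity.lean` for the
printed argument and its prerequisites.

## Consumer form of the case `τ = 1` (conditional on the named fact)

* `Literature.Geometry.Riemannian.PedersenPoon1994_selfDual_rigidity_chain.complexProjectivePlane`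
  — from `(h : PedersenPoon1994_selfDual_rigidity_chain)`: a connected sum `M = Σ # ℂℙ²` of a
  homotopy 4-sphere `Σ` with `ℂℙ²` (along arbitrary discs), simply connected and carrying a
  self-dual metric of positive scalar curvature for some orientation, is diffeomorphic to `ℂℙ²`
  itself (Cor. 2.1 with `τ = 1`: "`M` is diffeomorphic to `τℂℙ²`"). The chain `Q` delivered by the
  fact is closed up with the PROVED identity `S⁴ # X ≅ X`
  (`Literature.Topology.FourManifolds.nonempty_diffeomorph_of_isConnectedSum_sphere'`, Kervaire–Milnor 1963, Lemma 2.1,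
  `ConnectedSumSphereIdentity.lean`) after transporting `Q 0` to `S⁴`
  (`Literature.Topology.FourManifolds.IsConnectedSum.of_diffeomorph_left`). Companion of the case `τ = 0`,
  `PedersenPoon1994_selfDual_rigidity_chain.sphere` (`SelfDualRigidity.lean`).

## References

* [PedersenPoon1994] H. Pedersen, Y. S. Poon, Proc. AMS 121 (1994) 859–864, Thm. 2.1, Cor. 2.1.
* [Pedersen2017] H. Pedersen, Ch. 10 of *Twistor Theory* (S. Huggett, ed.), pp. 133–136, §3 (end).
* [KervaireMilnor1963] M. Kervaire, J. Milnor, Ann. of Math. 77 (1963), §2 (connected sums).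
* [Kosinski1993] A. Kosinski, *Differential Manifolds*, Ch. VI §1, Thm. (1.1).
-/

noncomputable section

open scoped Manifold ContDiff Topology
open Literature.Topology.FourManifolds Literature.Geometry.Lorentzian

namespace Literature.Geometry.Riemannian

/-- **The standard chain `S⁴, S⁴ # ℂℙ², (S⁴ # ℂℙ²) # ℂℙ², …` exists.** There is a sequence
`Q : ℕ → Type` of nonempty closed (compact, Hausdorff, second countable) smooth 4-manifolds with
`Q 0` diffeomorphic to (indeed equal to) the round sphere `S⁴` and `Q (i + 1)` a connected sum
`Q i # ℂℙ²` for every `i` — the reference manifolds "`S⁴ # nℂℙ²`" of Pedersen–Poon's conclusion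
(as unoriented connected sums). Proof: iterate the existence of connected sums of nonempty closed
smooth manifolds (`exists_isConnectedSum_holds`, Kervaire–Milnor 1963 §2 / Kosinski VI.(1.1))
along `ℕ`, bundling each stage with its instances in an anonymous `Σ`-type; a connected sum along
`4`-discs is again nonempty (`IsConnectedSum.nonempty`).
[cite: Kosinski1993, Ch. VI §1, Thm (1.1)] [cite: PedersenPoon1994, Cor. 2.1 (the manifolds `S⁴ # τℂℙ²`)] -/
theorem exists_sphere_connectedSum_complexProjectivePlane_chain :
    ∃ (Q : ℕ → Type) (_ : ∀ i, TopologicalSpace (Q i)) (_ : ∀ i, T2Space (Q i))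
      (_ : ∀ i, SecondCountableTopology (Q i))
      (_ : ∀ i, ChartedSpace (EuclideanSpace ℝ (Fin 4)) (Q i))
      (_ : ∀ i, IsManifold (𝓡 4) ∞ (Q i)) (_ : ∀ i, CompactSpace (Q i)) (_ : ∀ i, Nonempty (Q i)),
      Nonempty (Q 0 ≃ₘ⟮𝓡 4, 𝓡 4⟯ (Metric.sphere (0 : EuclideanSpace ℝ (Fin 5)) 1)) ∧
      ∀ i, IsConnectedSum (𝓡 4) (𝓡 4) (𝓡 4) (Q i) ComplexProjectivePlane (Q (i + 1)) := by
  classical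
  -- bundled nonempty closed smooth 4-manifolds in `Type`, as an anonymous `Σ`-type
  let B : Type 1 := Σ (X : Type), Σ (_ : TopologicalSpace X),
    { _c : ChartedSpace (EuclideanSpace ℝ (Fin 4)) X //
      T2Space X ∧ SecondCountableTopology X ∧ IsManifold (𝓡 4) ∞ X ∧ CompactSpace X ∧ Nonempty X }
  -- one step: a connected sum with `ℂℙ²` exists and is again such a manifold
  have hstep : ∀ b : B, ∃ b' : B,
      letI := b.2.1; letI := b.2.2.1; haveI := b.2.2.2.1
      letI := b'.2.1; letI := b'.2.2.1
      IsConnectedSum (𝓡 4) (𝓡 4) (𝓡 4) b.1 ComplexProjectivePlane b'.1 := by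
    rintro ⟨X, t, c, hT2, hSC, hM, hC, hN⟩
    obtain ⟨P, tP, h2P, scP, cP, mP, cpP, hP⟩ :=
      exists_isConnectedSum_holds.{0} (n := 4) X ComplexProjectivePlane
    exact ⟨⟨P, tP, cP, h2P, scP, mP, cpP, hP.nonempty⟩, hP⟩
  -- the base: the round 4-sphere
  let b₀ : B := ⟨Metric.sphere (0 : EuclideanSpace ℝ (Fin 5)) 1, inferInstance, inferInstance,
    inferInstance, inferInstance, inferInstance, inferInstance,
    (NormedSpace.sphere_nonempty.mpr zero_le_one).to_subtype⟩
  -- the chain, by recursion along `ℕ`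
  let Q : ℕ → B := fun i ↦ Nat.rec b₀ (fun _ b ↦ (hstep b).choose) i
  refine ⟨fun i ↦ (Q i).1, fun i ↦ (Q i).2.1, fun i ↦ (Q i).2.2.2.1, fun i ↦ (Q i).2.2.2.2.1,
    fun i ↦ (Q i).2.2.1, fun i ↦ (Q i).2.2.2.2.2.1, fun i ↦ (Q i).2.2.2.2.2.2.1,
    fun i ↦ (Q i).2.2.2.2.2.2.2, ?_, fun i ↦ ?_⟩
  · -- `Q 0` is the round sphere, definitionally
    exact ⟨Diffeomorph.refl (𝓡 4) (Metric.sphere (0 : EuclideanSpace ℝ (Fin 5)) 1) ∞⟩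
  · -- `Q (i + 1)` is the chosen connected sum `Q i # ℂℙ²`, definitionally
    exact (hstep (Q i)).choose_spec

/-- The `∃ Q …` clause of `PedersenPoon1994_selfDual_rigidity_chain`, verbatim, for every `n`:
a chain of closed smooth 4-manifolds `Q 0 ≅ S⁴`, `Q (i + 1)` a connected sum `Q i # ℂℙ²` for
`i < n` (restriction of `exists_sphere_connectedSum_complexProjectivePlane_chain`). What the named
fact adds to this — its entire geometric content — is the diffeomorphism `P n ≅ Q n`.
[cite: PedersenPoon1994, Cor. 2.1] [cite: Kosinski1993, Ch. VI §1, Thm (1.1)] -/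
theorem exists_sphere_connectedSum_complexProjectivePlane_chain_lt (n : ℕ) :
    ∃ (Q : ℕ → Type) (_ : ∀ i, TopologicalSpace (Q i)) (_ : ∀ i, T2Space (Q i))
      (_ : ∀ i, SecondCountableTopology (Q i))
      (_ : ∀ i, ChartedSpace (EuclideanSpace ℝ (Fin 4)) (Q i))
      (_ : ∀ i, IsManifold (𝓡 4) ∞ (Q i)) (_ : ∀ i, CompactSpace (Q i)),
      Nonempty (Q 0 ≃ₘ⟮𝓡 4, 𝓡 4⟯ (Metric.sphere (0 : EuclideanSpace ℝ (Fin 5)) 1)) ∧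
      (∀ i < n, IsConnectedSum (𝓡 4) (𝓡 4) (𝓡 4) (Q i) ComplexProjectivePlane (Q (i + 1))) := by
  obtain ⟨Q, i₁, i₂, i₃, i₄, i₅, i₆, -, h0, hQ⟩ :=
    exists_sphere_connectedSum_complexProjectivePlane_chain
  exact ⟨Q, i₁, i₂, i₃, i₄, i₅, i₆, h0, fun i _ ↦ hQ i⟩

/-- **Pedersen–Poon (1994), Cor. 2.1 with `τ = 1`, consumer form (conditional on the named fact
`PedersenPoon1994_selfDual_rigidity_chain`).** Let `Σ` be a homotopy 4-sphere and `M` a connected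
sum `Σ # ℂℙ²` (`IsConnectedSum`, along arbitrary smooth discs) which is a simply connected closed
smooth 4-manifold carrying an orientation `o` and a Riemannian metric `g` of positive scalar
curvature, self-dual for `o` (Hamilton's block `C` scalar in every `o`-positive `g`-orthonormal
frame). Then `M` is diffeomorphic to `ℂℙ²`. Printed: "If a compact, simply connected and self-dual
conformal 4-manifold `(M,[g])` of positive type has signature `τ ≤ 4` then `M` is diffeomorphic to
`τℂℙ²`" — here `τ = b₂ = 1`. Proof: the fact (with `n = 1`, `P = (Σ, M, M, …)`) gives a chain
`Q 0 ≅ S⁴`, `Q 1` a connected sum `Q 0 # ℂℙ²`, `M ≅ Q 1`; transporting `Q 0` to `S⁴`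
(`IsConnectedSum.of_diffeomorph_left`) and the proved identity `S⁴ # ℂℙ² ≅ ℂℙ²`
(`nonempty_diffeomorph_of_isConnectedSum_sphere'`, Kervaire–Milnor 1963, Lemma 2.1) give
`Q 1 ≅ ℂℙ²`. [cite: PedersenPoon1994, Cor. 2.1] [cite: Pedersen2017, Cor. 2.1 and §3 (end)]
[cite: KervaireMilnor1963, §2, Lemma 2.1] -/
theorem PedersenPoon1994_selfDual_rigidity_chain.complexProjectivePlane
    (h : PedersenPoon1994_selfDual_rigidity_chain) (S : HomotopySphere 4)
    (M : Type) [TopologicalSpace M] [T2Space M] [SecondCountableTopology M]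
    [ChartedSpace (EuclideanSpace ℝ (Fin 4)) M] [IsManifold (𝓡 4) ∞ M] [CompactSpace M]
    (hM : IsConnectedSum (𝓡 4) (𝓡 4) (𝓡 4) S.carrier ComplexProjectivePlane M)
    [SimplyConnectedSpace M] (o : SmoothOrientation (𝓡 4) M)
    (g : PseudoRiemannianMetric (𝓡 4) ∞ (EuclideanSpace ℝ (Fin 4)) (TangentSpace (𝓡 4) : M → Type _))
    [hLC : g.HasLeviCivita] (hg : g.IsRiemannian) (hs : ∀ x, 0 < g.scalarCurvature x)
    (hsd : ∀ (x : M) (e : Fin 4 → TangentSpace (𝓡 4) x), g.IsOrthonormalFrame x e →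
      0 < Module.Ray.someVector (o x) (fun i => e (Fin.cast finrank_euclideanSpace_fin i)) →
      g.blockC g.leviCivita x e =
        ((g.blockC g.leviCivita x e).trace / 3) • (1 : Matrix (Fin 3) (Fin 3) ℝ)) :
    Nonempty (M ≃ₘ⟮𝓡 4, 𝓡 4⟯ ComplexProjectivePlane) := by
  -- the two-stage family `P = (Σ, M, M, …)`, by recursion so that `P 0`, `P 1` unfold definitionally;
  -- its instance families are built the same way and passed to the fact explicitly
  let P : ℕ → Type := fun i ↦ Nat.rec S.carrier (fun _ _ ↦ M) i
  let tP : ∀ i, TopologicalSpace (P i) := fun i ↦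
    Nat.rec (motive := fun i ↦ TopologicalSpace (P i)) (inferInstance : TopologicalSpace S.carrier)
      (fun _ _ ↦ (inferInstance : TopologicalSpace M)) i
  have t2P : ∀ i, @T2Space (P i) (tP i) := fun i ↦
    Nat.rec (motive := fun i ↦ @T2Space (P i) (tP i)) (inferInstance : T2Space S.carrier)
      (fun _ _ ↦ (inferInstance : T2Space M)) i
  have scP : ∀ i, @SecondCountableTopology (P i) (tP i) := fun i ↦
    Nat.rec (motive := fun i ↦ @SecondCountableTopology (P i) (tP i))
      (inferInstance : SecondCountableTopology S.carrier)
      (fun _ _ ↦ (inferInstance : SecondCountableTopology M)) i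
  let cP : ∀ i, @ChartedSpace (EuclideanSpace ℝ (Fin 4)) _ (P i) (tP i) := fun i ↦
    Nat.rec (motive := fun i ↦ @ChartedSpace (EuclideanSpace ℝ (Fin 4)) _ (P i) (tP i))
      (inferInstance : ChartedSpace (EuclideanSpace ℝ (Fin 4)) S.carrier)
      (fun _ _ ↦ (inferInstance : ChartedSpace (EuclideanSpace ℝ (Fin 4)) M)) i
  have mP : ∀ i, @IsManifold ℝ _ (EuclideanSpace ℝ (Fin 4)) _ _ (EuclideanSpace ℝ (Fin 4)) _ (𝓡 4) ∞
      (P i) (tP i) (cP i) := fun i ↦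
    Nat.rec (motive := fun i ↦ @IsManifold ℝ _ (EuclideanSpace ℝ (Fin 4)) _ _
        (EuclideanSpace ℝ (Fin 4)) _ (𝓡 4) ∞ (P i) (tP i) (cP i))
      (inferInstance : IsManifold (𝓡 4) ∞ S.carrier)
      (fun _ _ ↦ (inferInstance : IsManifold (𝓡 4) ∞ M)) i
  have cpP : ∀ i, @CompactSpace (P i) (tP i) := fun i ↦
    Nat.rec (motive := fun i ↦ @CompactSpace (P i) (tP i)) (inferInstance : CompactSpace S.carrier)
      (fun _ _ ↦ (inferInstance : CompactSpace M)) i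
  -- the chain hypothesis of the fact for `n = 1` is `hM` (instances of `P i` passed explicitly:
  -- `P` is a local definition, invisible to instance search)
  have hP : ∀ i < 1, @IsConnectedSum _ _ _ _ _ (𝓡 4) _ _ _ _ _ (𝓡 4) _ _ _ _ _ (𝓡 4)
      (P i) ComplexProjectivePlane (P (i + 1)) (tP i) (t2P i) (cP i) _ _ _ (tP (i + 1))
      (cP (i + 1)) := by
    intro i hi
    obtain rfl : i = 0 := Nat.lt_one_iff.mp hi
    exact hM
  have hsc : @SimplyConnectedSpace (P 1) (tP 1) := ‹SimplyConnectedSpace M›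
  obtain ⟨Q, _, _, _, _, _, _, hQ0, hQ, hPQ⟩ :=
    @h S 1 (by norm_num) P tP t2P scP cP mP cpP ⟨Diffeomorph.refl (𝓡 4) S.carrier ∞⟩ hP hsc o g
      hLC hg hs hsd
  obtain ⟨e₀⟩ := hQ0
  obtain ⟨e₁⟩ := hPQ
  have e₁' : M ≃ₘ⟮𝓡 4, 𝓡 4⟯ Q 1 := e₁
  -- `Q 1` is a connected sum `S⁴ # ℂℙ²`, hence `ℂℙ² # S⁴`, hence diffeomorphic to `ℂℙ²`
  obtain ⟨e⟩ := nonempty_diffeomorph_of_isConnectedSum_sphere'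
    ((hQ 0 Nat.zero_lt_one).of_diffeomorph_left e₀).symm
  exact ⟨e₁'.trans e⟩

end Literature.Geometry.Riemannian

end
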